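import Mathlib
import HarnessLib
import Literature.Analysis.FluidPDE.TypeIAncientMild
import Literature.Analysis.FluidPDE.VorticityCalculus
import Summits.NavierStokesRegularity.NavierStokesRegularity.Theorems.IsobarTomographyBlobRiccatiClosureTypeIGaugeBounds
import Summits.NavierStokesRegularity.NavierStokesRegularity.Theorems.IsobarTomographyBlobRiccatiClosureSmallScaledVorticityLiouville

/-!
# Crux `IsobarTomography.BlobRiccatiClosure` (stmt-NavierStokesRegularity-11740), line
# `type-i-apex-liouville` — apex structure IV: the scale floor of an apex

Helper file (theorems only) `--supports` the item (registered stub `stub_apexScaleFloor`, the last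
theorem). Continues the list of what an APEX `(σ, 0)` of a Type-I ancient mild field provably
carries (I–III: `stub_apexStretching`, `stub_apexStretchingSharp`, `stub_apexSpatial`, lead c2):

* **IV (scale floor, `stub_apexScaleFloor`).** `ε(C) ≤ −σ`: the scaled vorticity maximum `G = −σ`
  of a field carrying an apex is bounded below by a class constant — the contrapositive of the
  small-scaled-vorticity Liouville theorem (`stub_smallScaledVorticityLiouville`).
* **IV′ (gradient-to-vorticity ratio, `apexScaleFloor_and_gradient_ratio`).**
  `‖∇W(σ)(0)‖ ≤ (K(C)/ε(C)) ‖curl W(σ, 0)‖` (the gauge bound `(−σ)‖∇W(σ)‖ ≤ K₁` divided by the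
  floor): an apex is never arbitrarily strain-dominated. The κ-free form of the residual C
  (`apexAntiBlob_iff_signs`, Theorems/…TypeIApexGlue.lean) asks `|S|² ≤ ½‖ω‖²` at every apex;
  IV′ is its qualitative, class-uniform version and the first apex-specific statement beyond the
  Danskin conditions.

## References

* G. Koch, N. Nadirashvili, G. Seregin, V. Šverák, Acta Math. 203 (2009) = arXiv:0709.3599,
  Prop. 4.1, §6. [KochNadirashviliSereginSverak2009]
-/

noncomputable section

open Set Filter Topology Function

-- the summit and its single sub-problem share the name (CONVENTIONS §1), as in every Theorems file
set_option linter.dupNamespace false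

namespace Summit.NavierStokesRegularity.NavierStokesRegularity.Theorems.BlobRiccatiClosure.TypeIApexLiouville

open Literature.Analysis Literature.Analysis.FluidPDE

/-! ### Apex structure IV — the scale floor -/

/-- **The apex scale floor with the gradient-to-vorticity ratio bound.** For every Type-I
constant `C` there are `ε = ε(C) > 0` and `K = K(C) ≥ 0` such that at every apex `(σ, 0)` of a
Type-I ancient mild field `W` — `‖curl W(σ, 0)‖ = 1` and `(−s)‖curl W(s, y)‖ ≤ −σ` on the whole
slab — one has `ε ≤ −σ` AND `‖∇W(σ)(0)‖ ≤ K/ε = (K/ε) ‖curl W(σ, 0)‖`: an apex cannot sit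
arbitrarily early on the self-similar clock, and its velocity gradient (a fortiori its strain) is
at most a class constant times its vorticity. The first is the small-scaled-vorticity Liouville
theorem read contrapositively (if `−σ < ε` the apex bound makes the scaled vorticity `ε`-small
everywhere, so `W ≡ 0`, contradicting `‖curl W(σ,0)‖ = 1`); the second is the class-uniform gauge
bound `(−σ)‖∇W(σ)‖ ≤ K₁` divided by `−σ ≥ ε`. Since the κ-free form of the residual
`stub_apexAntiBlob` asks `|S|² ≤ ½‖ω‖²` at every apex (`apexAntiBlob_iff_signs`), this is its
qualitative, class-uniform version. [folklore] -/
theorem apexScaleFloor_and_gradient_ratio :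
    ∀ C : ℝ, ∃ ε K : ℝ, 0 < ε ∧ 0 ≤ K ∧
      ∀ (W : ℝ → EuclideanSpace ℝ (Fin 3) → EuclideanSpace ℝ (Fin 3)) (σ : ℝ), IsTypeIAncientMild C W →
        σ < 0 → ‖curl (W σ) 0‖ = 1 →
        (∀ s < 0, ∀ y : EuclideanSpace ℝ (Fin 3), (-s) * ‖curl (W s) y‖ ≤ -σ) →
        ε ≤ -σ ∧ ‖fderiv ℝ (W σ) 0‖ ≤ K / ε := by
  intro C
  obtain ⟨ε, hε, hL⟩ := stub_smallScaledVorticityLiouville C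
  obtain ⟨K₁, K₂, hK₁, -, hG⟩ := stub_typeIGaugeBounds C
  refine ⟨ε, K₁, hε, hK₁, fun W σ hW hσ h1 hapex => ?_⟩
  -- the floor
  have hfloor : ε ≤ -σ := by
    by_contra hlt
    rw [not_le] at hlt
    have hsmall : ∀ t < 0, ∀ x, (-t) * ‖curl (W t) x‖ ≤ ε := fun t ht x =>
      (hapex t ht x).trans hlt.le
    have hzero : ∀ x, W σ x = 0 := hL W hW hsmall σ hσ
    have hWσ : W σ = fun _ => (0 : EuclideanSpace ℝ (Fin 3)) := funext hzero
    rw [hWσ, curl_fun_zero, norm_zero] at h1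
    exact zero_ne_one h1
  refine ⟨hfloor, ?_⟩
  -- the ratio: `(−σ)‖∇W(σ)(0)‖ ≤ K₁` and `ε ≤ −σ`
  have hg := (hG W hW σ hσ 0).1
  rw [le_div_iff₀ hε]
  calc ‖fderiv ℝ (W σ) 0‖ * ε ≤ ‖fderiv ℝ (W σ) 0‖ * (-σ) :=
        mul_le_mul_of_nonneg_left hfloor (norm_nonneg _)
    _ = (-σ) * ‖fderiv ℝ (W σ) 0‖ := mul_comm _ _
    _ ≤ K₁ := hg

/-- **Apex scale floor (registered stub `stub_apexScaleFloor`).** For every Type-I constant `C`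
there is `ε = ε(C) > 0` such that every apex `(σ, 0)` of a Type-I ancient mild field with
constant `C` (`‖curl W(σ,0)‖ = 1`, `(−s)‖curl W(s,y)‖ ≤ −σ` for all `s < 0`, `y`) satisfies
`ε ≤ −σ`: the scale-invariant vorticity maximum `G = −σ` of a Type-I ancient mild field carrying an
apex is bounded below by a class constant (contrapositive of the small-scaled-vorticity Liouville
theorem `stub_smallScaledVorticityLiouville`). [folklore] -/
theorem stub_apexScaleFloor : ∀ C : ℝ, ∃ ε : ℝ, 0 < ε ∧ ∀ (W : ℝ → EuclideanSpace ℝ (Fin 3) → EuclideanSpace ℝ (Fin 3)) (σ : ℝ), IsTypeIAncientMild C W → σ < 0 → ‖curl (W σ) 0‖ = 1 → (∀ s < 0, ∀ y : EuclideanSpace ℝ (Fin 3), (-s) * ‖curl (W s) y‖ ≤ -σ) → ε ≤ -σ := by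
  intro C
  obtain ⟨ε, K, hε, -, h⟩ := apexScaleFloor_and_gradient_ratio C
  exact ⟨ε, hε, fun W σ hW hσ h1 hapex => (h W σ hW hσ h1 hapex).1⟩

end Summit.NavierStokesRegularity.NavierStokesRegularity.Theorems.BlobRiccatiClosure.TypeIApexLiouville

end
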